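import Literature.NumberTheory.Automorphic.UnitaryThreeDoubleCosetsHKStabilizer      -- ★ (F1) B-p17 files 1–2: frame, `u_m`, `H`, `K₀`, `H^K_m` by congruences
import HarnessLib

/-!
# Flicker's Proposition 8, first half, in the quasi-split frame: `K_H ⊆ P_H · H^K_m` (every integral element of `H = Z_U(diag(1,−1,1))` is an
# UPPER-TRIANGULAR integral element of `H` times an element of `⋂_m H^K_m`), and `H^K_m ≤ K_H`
(Flicker, *Elementary proof of the fundamental lemma for a unitary group* (1998), Prop. 8 p. 84; Prop. 4 p. 81)

Topic `NumberTheory/Automorphic`; namespace `Literature.NumberTheory.Automorphic.UnitaryGroup`.  THEOREMS ONLY (no `def`, no instance, no notation, no named fact,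
no `sorry`).  Cell `pub/hodgecm-mathlib`, F0∕P3a road «N7-ns COUNT FROM FLICKER» (MAP v3, architect A-p06 (g26)), brick **(F3c-β)** of (F3) «H-decompositions +
order indices» (B-p04 (g33), heir of F0P2-p06 (g5); LEAD F0P3a-plan (g9) T8-49 (C)), over ★ (F1) B-p17 (g24) `UnitaryThreeDoubleCosetsHK{,Stabilizer}`.
It discharges the two hypotheses `hKPM` («`K ⊆ P·M`») and `hMK` («`M ≤ K`») of ★ (F3c-α) `DoubleCosetFixedPoints.natCard_fixedPoints_eq_finsum_relIndex_mul`
(FLICKER COR. 9, COUNTED) at `K := K_H = H ∩ K₀`, `M := H^K_m = H ∩ u_m K₀ u_m⁻¹`, `P := P_H·E¹ = {h ∈ K_H : h₂₀ = 0}` — A-p03 (g24)'s LAYER C.  HC_CM is proved only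
modulo the printed citations until rung 0 closes; structure theory for ONE clause of #103-ns, pays nothing by itself.

FRAME (= ★ (F1)): `K` valued in `ℤᵐ⁰` with a `LocalConjDatum σ ϖ`; `U = U(σ, Φ₃)`, `hJ : J = (StdForm.antidiagonal 3).over K`; `K₀ = unitaryInt σ J`; `c` with matrix
`diag(1,−1,1)`, `H = Z_U(c)` whose elements are blocks `!![α,0,β; 0,e,0; γ,0,δ]` (★ `exists_coe_eq_block_of_mem_centralizer`); `y σy = −2`; `u = u_m` by the hypothesis
`hu : ↑↑u = !![ϖ^m, y, ϖ^{-m}; 0, 1, −σy ϖ^{-m}; 0, 0, ϖ^{-m}]`; `H^K_m` membership = ★ (C2) `flickerU_inv_mul_mul_flickerU_mem_unitaryInt_iff` (four congruences).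

* `block_relations_of_coe_eq` — the five unitarity relations of a block `σα·γ + σγ·α = 0`, `σα·δ + σγ·β = 1`, `σβ·γ + σδ·α = 1`, `σβ·δ + σδ·β = 0`, `σe·e = 1`
  (★ `sum_rel_of_mem`); `mem_centralizer_of_coe_eq_block` (a block commutes with `c`).
* **`exists_upper_mul_of_mem_centralizer_unitaryInt`** — PROP. 8: for `k ∈ H ∩ K₀`, `∃ p x ∈ U`, `p ∈ H ∩ K₀` with `p₂₀ = 0`, `x ∈ H` with `u_m⁻¹ x u_m ∈ K₀`, `k = p x`.
  PROOF (print p. 84 «`K_H` consists of `(u 0; 0 ū⁻¹)(1 ù√D; 0 1)·ã⁻¹(d̄ c√D; c√D d)`», made explicit in the `Φ₃` frame): `γ + δ` is a UNIT (from `σγ·D = −γ`, `σδ·D = δ`,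
  `D = αδ − βγ`: `|γ − δ| ≤ |γ + δ|`, and both `< 1` contradicts `σα δ + σγ β = 1`); `p := !![u₀, 0, u₀ z; 0, e, 0; 0, 0, γ+δ]`, `u₀ = (σγ+σδ)⁻¹`,
  `z = (σγ+σδ)(α+β) − 1` (ANTI-FIXED by the relations) lies in `U` (nine sums), in `H` (block) and in `K₀` (entries); `x := p⁻¹ k = !![α′,0,β′; 0,1,0; γ′,0,δ′]` with
  `α′ + γ′ = 1`, `γ′ + δ′ = 1`, `α′+β′+γ′+δ′ = 2` EXACTLY, so ★ (C2) holds at EVERY level `m`.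
* **`mem_unitaryInt_of_flickerU_conj_mem`** — `H^K_m ≤ K_H`: ★ (C2)'s congruences force every entry of `h` to be integral.

## References
* [Flicker1998UnitaryFL] Y. Z. Flicker, *Elementary proof of the fundamental lemma for a unitary group*, Canad. J. Math. 50 (1998), §2 p. 78, Prop. 4 p. 81, Prop. 8 p. 84.
* [Rogawski1990] J. D. Rogawski, *Automorphic Representations of Unitary Groups in Three Variables* (1990), §1.9–§1.10 pp. 8–9.
-/

set_option autoImplicit false

open scoped MatrixGroups WithZero
open Matrix

namespace Literature.NumberTheory.Automorphic

namespace UnitaryGroup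

open Literature.NumberTheory.Automorphic.HermitianLattice (unitaryInt mem_unitaryInt_iff LocalConjDatum)

section KHFactor

variable {K : Type*} [Field K] [Valued K ℤᵐ⁰] {ϖ : K}
  (σ : K →+* K) {J : Matrix (Fin 3) (Fin 3) K} (hJ : J = (StdForm.antidiagonal 3).over K)

/-- `rev` on `Fin 3`. [folklore] -/ private theorem rev0' : Fin.rev (0 : Fin 3) = 2 := rfl
/-- `rev` on `Fin 3`. [folklore] -/ private theorem rev1' : Fin.rev (1 : Fin 3) = 1 := rfl
/-- `rev` on `Fin 3`. [folklore] -/ private theorem rev2' : Fin.rev (2 : Fin 3) = 0 := rfl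

omit [Valued K ℤᵐ⁰] in
include hJ in
/-- **The unitarity relations of a block element** `h = !![α,0,β; 0,e,0; γ,0,δ] ∈ U(σ, Φ₃)`: `σα·γ + σγ·α = 0`, `σα·δ + σγ·β = 1`, `σβ·γ + σδ·α = 1`,
`σβ·δ + σδ·β = 0`, `σe·e = 1`. [cite: Flicker1998UnitaryFL, §2 p. 78; Prop. 8 p. 84] -/
theorem block_relations_of_coe_eq (h : ↥(unitaryGroupOfForm σ J)) {α β γ δ e : K}
    (hh : ((h : GL (Fin 3) K) : Matrix (Fin 3) (Fin 3) K) = !![α, 0, β; 0, e, 0; γ, 0, δ]) :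
    σ α * γ + σ γ * α = 0 ∧ σ α * δ + σ γ * β = 1 ∧ σ β * γ + σ δ * α = 1 ∧ σ β * δ + σ δ * β = 0 ∧ σ e * e = 1 := by
  have r00 := sum_rel_of_mem σ hJ h 0 0
  have r02 := sum_rel_of_mem σ hJ h 0 2
  have r20 := sum_rel_of_mem σ hJ h 2 0
  have r22 := sum_rel_of_mem σ hJ h 2 2
  have r11 := sum_rel_of_mem σ hJ h 1 1
  simp only [hh, Fin.sum_univ_three, rev0', rev1', rev2', Matrix.of_apply, Matrix.cons_val', Matrix.cons_val_zero, Matrix.cons_val_one,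
    Matrix.cons_val_two, Matrix.cons_val_fin_one, Matrix.tail_cons, Matrix.head_cons, Matrix.empty_val', map_zero, mul_zero,
    zero_mul, add_zero, zero_add, Fin.isValue] at r00 r02 r20 r22 r11
  refine ⟨by simpa using r00, by simpa using r02, by simpa using r20, by simpa using r22, by simpa using r11⟩

omit [Valued K ℤᵐ⁰] in
/-- A block-shaped element of `U` commutes with `c = diag(1,−1,1)`. [cite: Flicker1998UnitaryFL, §2 p. 78] -/
theorem mem_centralizer_of_coe_eq_block {c g : ↥(unitaryGroupOfForm σ J)}
    (hc : ((c : GL (Fin 3) K) : Matrix (Fin 3) (Fin 3) K) = !![1, 0, 0; 0, -1, 0; 0, 0, 1]) {α β γ δ e : K}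
    (hg : ((g : GL (Fin 3) K) : Matrix (Fin 3) (Fin 3) K) = !![α, 0, β; 0, e, 0; γ, 0, δ]) :
    g ∈ Subgroup.centralizer ({c} : Set ↥(unitaryGroupOfForm σ J)) := by
  rw [Subgroup.mem_centralizer_singleton_iff]
  apply Subtype.ext; apply Units.ext
  rw [Subgroup.coe_mul, Subgroup.coe_mul, Units.val_mul, Units.val_mul, hc, hg]
  ext i j
  fin_cases i <;> fin_cases j <;> simp [Matrix.mul_apply, Fin.sum_univ_three]

include hJ in
/-- **FLICKER'S PROPOSITION 8 (first half): `K_H ⊆ P_H · H^K_m` for every `m`.**  For an INTEGRAL `k = !![α,0,β;0,e,0;γ,0,δ] ∈ H = Z_U(diag(1,−1,1))`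
(`k ∈ K₀`), `γ + δ` is a unit, and with `u₀ = (σγ + σδ)⁻¹`, `z = (σγ+σδ)(α+β) − 1` (anti-fixed) the UPPER-TRIANGULAR integral element
`p = !![u₀, 0, u₀ z; 0, e, 0; 0, 0, γ + δ] ∈ H ∩ K₀` satisfies `k = p · x` with `x ∈ H` and `u_m⁻¹ x u_m ∈ K₀` for EVERY `m` — indeed
`x = !![α′,0,β′;0,1,0;γ′,0,δ′]` has `α′ + γ′ = γ′ + δ′ = 1` and `α′+β′+γ′+δ′ = 2` exactly, so ★ (C2)'s congruences hold at every level (print p. 84: «`K_H` consists of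
`(u 0; 0 ū⁻¹)(1 ù√D; 0 1)·ã⁻¹(d̄ c√D; c√D d)`», and `K_H × E¹ = P_H H^K_m`).  This is the hypothesis `hKPM` of ★ `natCard_fixedPoints_eq_finsum_relIndex_mul` ((F3c-α)).
[cite: Flicker1998UnitaryFL, Prop. 8 p. 84] -/
theorem exists_upper_mul_of_mem_centralizer_unitaryInt (hd : LocalConjDatum σ ϖ) {y : K} (hy : y * σ y = -2) (m : ℕ)
    {u c k : ↥(unitaryGroupOfForm σ J)}
    (hu : ((u : GL (Fin 3) K) : Matrix (Fin 3) (Fin 3) K) = !![ϖ ^ m, y, (ϖ ^ m)⁻¹; 0, 1, -σ y * (ϖ ^ m)⁻¹; 0, 0, (ϖ ^ m)⁻¹])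
    (hc : ((c : GL (Fin 3) K) : Matrix (Fin 3) (Fin 3) K) = !![1, 0, 0; 0, -1, 0; 0, 0, 1])
    (hkH : k ∈ Subgroup.centralizer ({c} : Set ↥(unitaryGroupOfForm σ J))) (hkK : k ∈ unitaryInt σ J) :
    ∃ p x : ↥(unitaryGroupOfForm σ J),
      (p ∈ Subgroup.centralizer ({c} : Set ↥(unitaryGroupOfForm σ J)) ∧ p ∈ unitaryInt σ J ∧ ((p : GL (Fin 3) K) : Matrix (Fin 3) (Fin 3) K) 2 0 = 0) ∧
      (x ∈ Subgroup.centralizer ({c} : Set ↥(unitaryGroupOfForm σ J)) ∧ u⁻¹ * x * u ∈ unitaryInt σ J) ∧ k = p * x := by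
  have h2v : Valued.v (2 : K) = 1 := hd.v2
  have h2 : (2 : K) ≠ 0 := fun h => by rw [h, map_zero] at h2v; exact zero_ne_one h2v
  have hσσ : ∀ x, σ (σ x) = x := hd.σσ
  -- the block shape of `k`, its relations, its integrality
  obtain ⟨α, β, γ, δ, e, hk⟩ := exists_coe_eq_block_of_mem_centralizer σ h2 hc hkH
  obtain ⟨hi, hii, hiii, hiv, hv⟩ := block_relations_of_coe_eq σ hJ k hk
  have hint := (mem_unitaryInt_iff_forall_v_apply_le_one σ hJ hd.vσ k).1 hkK
  have hα : Valued.v α ≤ 1 := by simpa [hk] using hint 0 0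
  have hβ : Valued.v β ≤ 1 := by simpa [hk] using hint 0 2
  have hγ : Valued.v γ ≤ 1 := by simpa [hk] using hint 2 0
  have hδ : Valued.v δ ≤ 1 := by simpa [hk] using hint 2 2
  have he : Valued.v e = 1 := v_eq_one_of_coe_eq_block σ hJ hd.vσ hk
  -- `σγ·D = −γ`, `σδ·D = δ`
  have hD : (σ γ + σ δ) * (α * δ - β * γ) = δ - γ := by linear_combination δ * hi - γ * hii + δ * hiii - γ * hiv
  -- `γ + δ` is a unit
  have hγδ : Valued.v (γ + δ) = 1 := by
    have hle : Valued.v (γ + δ) ≤ 1 := (Valuation.map_add _ _ _).trans (max_le hγ hδ)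
    by_contra hne
    have hlt : Valued.v (γ + δ) < 1 := lt_of_le_of_ne hle hne
    have hdiff : Valued.v (δ - γ) < 1 := by
      rw [← hD, map_mul]
      have h1 : Valued.v (σ γ + σ δ) < 1 := by rw [← map_add, hd.vσ]; exact hlt
      have h2' : Valued.v (α * δ - β * γ) ≤ 1 :=
        (Valuation.map_sub _ _ _).trans (max_le (by rw [map_mul]; exact mul_le_one' hα hδ) (by rw [map_mul]; exact mul_le_one' hβ hγ))
      calc Valued.v (σ γ + σ δ) * Valued.v (α * δ - β * γ) ≤ Valued.v (σ γ + σ δ) * 1 := mul_le_mul' le_rfl h2'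
        _ < 1 := by rw [mul_one]; exact h1
    have hγ1 : Valued.v γ < 1 := by
      have : γ = 2⁻¹ * ((γ + δ) - (δ - γ)) := by field_simp; ring
      rw [this, map_mul, map_inv₀, h2v, inv_one, one_mul]
      exact Valuation.map_sub_lt _ hlt hdiff
    have hδ1 : Valued.v δ < 1 := by
      have : δ = 2⁻¹ * ((γ + δ) + (δ - γ)) := by field_simp; ring
      rw [this, map_mul, map_inv₀, h2v, inv_one, one_mul]
      exact Valuation.map_add_lt _ hlt hdiff
    have h1 : Valued.v (σ α * δ + σ γ * β) < 1 :=
      Valuation.map_add_lt _ (by rw [map_mul, hd.vσ]; exact (mul_le_mul' hα le_rfl).trans_lt (by rw [one_mul]; exact hδ1))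
        (by rw [map_mul, hd.vσ]; exact (mul_le_mul' le_rfl hβ).trans_lt (by rw [mul_one]; exact hγ1))
    rw [hii, map_one] at h1
    exact lt_irrefl _ h1
  have hγδ0 : γ + δ ≠ 0 := fun h => by rw [h, map_zero] at hγδ; exact zero_ne_one hγδ
  have hσγδ0 : σ γ + σ δ ≠ 0 := by rw [← map_add]; exact fun h => hγδ0 (by rw [← hσσ (γ + δ), h, map_zero])
  -- the parameters
  set s : K := (γ + δ)⁻¹ with hs_def
  set u₀ : K := (σ γ + σ δ)⁻¹ with hu₀_def
  set z : K := (σ γ + σ δ) * (α + β) - 1 with hz_def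
  have hs : s * (γ + δ) = 1 := inv_mul_cancel₀ hγδ0
  have hu₀ : u₀ * (σ γ + σ δ) = 1 := inv_mul_cancel₀ hσγδ0
  have hσs : σ s = u₀ := by rw [hs_def, map_inv₀, map_add]
  have hσu₀ : σ u₀ = s := by rw [hu₀_def, map_inv₀, map_add, hσσ, hσσ]
  have hz : σ z = -z := by
    rw [hz_def, map_sub, map_mul, map_add, map_add, hσσ, hσσ, map_one]
    linear_combination hi + hii + hiii + hiv
  -- valuations of the parameters
  have vs : Valued.v s = 1 := by rw [hs_def, map_inv₀, hγδ, inv_one]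
  have vu₀ : Valued.v u₀ = 1 := by rw [← hσs, hd.vσ, vs]
  have vz : Valued.v z ≤ 1 := by
    refine (Valuation.map_sub _ _ _).trans (max_le ?_ (by rw [map_one]))
    rw [map_mul, ← map_add, hd.vσ, hγδ, one_mul]
    exact (Valuation.map_add _ _ _).trans (max_le hα hβ)
  -- the matrix `P` of `p` and its membership in `U`
  have hPU : Matrix.GeneralLinearGroup.mkOfDetNeZero (!![u₀, 0, u₀ * z; 0, e, 0; 0, 0, γ + δ] : Matrix (Fin 3) (Fin 3) K)
      (by rw [Matrix.det_fin_three]; simp; exact ⟨⟨inv_ne_zero hσγδ0, fun h => by rw [h, map_zero] at he; exact zero_ne_one he⟩, hγδ0⟩) ∈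
      unitaryGroupOfForm σ J := by
    rw [hJ, mem_unitaryGroupOfForm_antidiagonal_iff_sum']
    intro a b
    simp only [Matrix.GeneralLinearGroup.val_mkOfDetNeZero]
    have e1 : σ u₀ * (γ + δ) = 1 := by rw [hσu₀, hs]
    have e2 : (σ γ + σ δ) * u₀ = 1 := by rw [mul_comm, hu₀]
    have e3 : σ u₀ * σ z * (γ + δ) + (σ γ + σ δ) * (u₀ * z) = 0 := by
      rw [hσu₀, hz]
      linear_combination (-z) * hs + z * hu₀
    fin_cases a <;> fin_cases b <;>
      simp [Fin.sum_univ_three, rev1', rev2', map_zero, e1, e2, hv]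
    · exact e3
  set p : ↥(unitaryGroupOfForm σ J) := ⟨_, hPU⟩ with hp_def
  have hp : ((p : GL (Fin 3) K) : Matrix (Fin 3) (Fin 3) K) = !![u₀, 0, u₀ * z; 0, e, 0; 0, 0, γ + δ] :=
    Matrix.GeneralLinearGroup.val_mkOfDetNeZero _ _
  -- the cofactor `x = p⁻¹ k` and its matrix
  set x : ↥(unitaryGroupOfForm σ J) := p⁻¹ * k with hx_def
  have hX : ((x : GL (Fin 3) K) : Matrix (Fin 3) (Fin 3) K) =
      !![(σ γ + σ δ) * α - z * s * γ, 0, (σ γ + σ δ) * β - z * s * δ; 0, 1, 0; s * γ, 0, s * δ] := by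
    -- `P · X = k`
    have hPX : ((p : GL (Fin 3) K) : Matrix (Fin 3) (Fin 3) K) *
        !![(σ γ + σ δ) * α - z * s * γ, 0, (σ γ + σ δ) * β - z * s * δ; 0, 1, 0; s * γ, 0, s * δ] = ((k : GL (Fin 3) K) : Matrix (Fin 3) (Fin 3) K) := by
      rw [hp, hk]
      ext i j
      fin_cases i <;> fin_cases j <;> simp [Matrix.mul_apply, Fin.sum_univ_three]
      · linear_combination α * hu₀
      · linear_combination β * hu₀
      · linear_combination γ * hs
      · linear_combination δ * hs
    have hinv : (((p : GL (Fin 3) K)⁻¹ : GL (Fin 3) K) : Matrix (Fin 3) (Fin 3) K) * ((p : GL (Fin 3) K) : Matrix (Fin 3) (Fin 3) K) = 1 := by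
      rw [← Units.val_mul, inv_mul_cancel, Units.val_one]
    rw [hx_def, Subgroup.coe_mul, Subgroup.coe_inv, Units.val_mul, ← hPX, ← Matrix.mul_assoc, hinv, Matrix.one_mul]
  -- the four congruence quantities are EXACT
  have c1 : (σ γ + σ δ) * α - z * s * γ + s * γ - 1 = 0 := by
    rw [hz_def]; linear_combination s * hD - ((σ γ + σ δ) * α - 1) * hs
  have c2 : s * γ + s * δ - 1 = 0 := by linear_combination hs
  have c3 : (σ γ + σ δ) * α - z * s * γ + ((σ γ + σ δ) * β - z * s * δ) + s * γ + s * δ - 2 * 1 = 0 := by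
    rw [hz_def]; linear_combination (-((σ γ + σ δ) * α - 1) + (1 - (σ γ + σ δ) * β)) * hs
  refine ⟨p, x, ⟨mem_centralizer_of_coe_eq_block σ hc hp, ?_, by rw [hp]; rfl⟩, ⟨mem_centralizer_of_coe_eq_block σ hc hX, ?_⟩,
    by rw [hx_def, mul_inv_cancel_left]⟩
  · -- `p ∈ K₀` by entries
    refine (mem_unitaryInt_iff_forall_v_apply_le_one σ hJ hd.vσ p).2 fun i j => ?_
    rw [hp]
    fin_cases i <;> fin_cases j <;> simp [vu₀.le, he.le, hγδ.le]
    · rw [vu₀, one_mul]; exact vz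
  · -- `u_m⁻¹ x u_m ∈ K₀` by ★ (C2): all four congruence quantities vanish
    refine (flickerU_inv_mul_mul_flickerU_mem_unitaryInt_iff σ hJ hd hy m hu hX).2 ⟨?_, ?_, ?_, ?_⟩
    · rw [map_mul, vs, one_mul]; exact hγ
    · rw [c1, map_zero]; exact zero_le
    · rw [c2, map_zero]; exact zero_le
    · rw [c3, map_zero]; exact zero_le

include hJ in
/-- **`H^K_m ≤ K_H`**: if `h ∈ H` and `u_m⁻¹ h u_m ∈ K₀` then `h ∈ K₀` — ★ (C2)'s congruences force every entry of `h` to be integral (`|t| ≤ 1`, `|e| = 1`).  This is the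
hypothesis `hMK : M ≤ K` of ★ `natCard_fixedPoints_eq_finsum_relIndex_mul` ((F3c-α)). [cite: Flicker1998UnitaryFL, Prop. 4 p. 81; Prop. 8 p. 84] -/
theorem mem_unitaryInt_of_flickerU_conj_mem (hd : LocalConjDatum σ ϖ) {y : K} (hy : y * σ y = -2) (m : ℕ)
    {u c h : ↥(unitaryGroupOfForm σ J)}
    (hu : ((u : GL (Fin 3) K) : Matrix (Fin 3) (Fin 3) K) = !![ϖ ^ m, y, (ϖ ^ m)⁻¹; 0, 1, -σ y * (ϖ ^ m)⁻¹; 0, 0, (ϖ ^ m)⁻¹])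
    (hc : ((c : GL (Fin 3) K) : Matrix (Fin 3) (Fin 3) K) = !![1, 0, 0; 0, -1, 0; 0, 0, 1])
    (hhH : h ∈ Subgroup.centralizer ({c} : Set ↥(unitaryGroupOfForm σ J))) (hhu : u⁻¹ * h * u ∈ unitaryInt σ J) :
    h ∈ unitaryInt σ J := by
  have h2v : Valued.v (2 : K) = 1 := hd.v2
  have h2 : (2 : K) ≠ 0 := fun h0 => by rw [h0, map_zero] at h2v; exact zero_ne_one h2v
  obtain ⟨α, β, γ, δ, e, hh⟩ := exists_coe_eq_block_of_mem_centralizer σ h2 hc hhH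
  have he : Valued.v e = 1 := v_eq_one_of_coe_eq_block σ hJ hd.vσ hh
  obtain ⟨hγ, hα', hδ', hβ'⟩ := (flickerU_inv_mul_mul_flickerU_mem_unitaryInt_iff σ hJ hd hy m hu hh).1 hhu
  have hϖ1 : Valued.v ϖ ≤ 1 := by rw [hd.vϖ, ← WithZero.exp_zero]; exact WithZero.exp_le_exp.2 (by norm_num)
  have ht1 : Valued.v (ϖ ^ m) ≤ 1 := by rw [map_pow]; exact pow_le_one' hϖ1 m
  have hα : Valued.v α ≤ 1 := by
    have e1 : α = (α + γ - e) - γ + e := by ring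
    rw [e1]
    refine (Valuation.map_add _ _ _).trans (max_le ((Valuation.map_sub _ _ _).trans (max_le (hα'.trans ht1) hγ)) he.le)
  have hδ : Valued.v δ ≤ 1 := by
    have e1 : δ = (γ + δ - e) - γ + e := by ring
    rw [e1]
    refine (Valuation.map_add _ _ _).trans (max_le ((Valuation.map_sub _ _ _).trans (max_le (hδ'.trans ht1) hγ)) he.le)
  have hβ : Valued.v β ≤ 1 := by
    have e1 : β = (α + β + γ + δ - 2 * e) - α - γ - δ + 2 * e := by ring
    rw [e1]
    refine (Valuation.map_add _ _ _).trans (max_le ?_ (by rw [map_mul, h2v, one_mul]; exact he.le))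
    refine (Valuation.map_sub _ _ _).trans (max_le ((Valuation.map_sub _ _ _).trans (max_le ((Valuation.map_sub _ _ _).trans
      (max_le (hβ'.trans (mul_le_one' ht1 ht1)) hα)) hγ)) hδ)
  refine (mem_unitaryInt_iff_forall_v_apply_le_one σ hJ hd.vσ h).2 fun i j => ?_
  rw [hh]
  fin_cases i <;> fin_cases j <;> simp [hα, hβ, hγ, hδ, he.le]

end KHFactor

end UnitaryGroup

end Literature.NumberTheory.Automorphic
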